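import Summits.AtomisticToContinuum.Crystallization.Cruxes.TruncatedCensusGap.IdeatorThreeSketch

/-!
# TriageR1K3 — crux-triage r1 k=3 (g2) Lean evidence — card metrical-charge-coercivity's two lemmas are NECESSARY
conditions of the crux (crux `stmt-AtomisticToContinuum-14230`, `TruncatedCensusGap`).

* `metricalChargeGap_of_tcg`   : `TruncatedCensusGap → Sketch.MetricalChargeGap` (take `C = 0`;
  the metrical set `M` is a subset of the charged set).
* `topologicalChargeGap_of_tcg`: `TruncatedCensusGap → Sketch.TopologicalChargeGap` (the
  topological set `T` is a subset of the charged set since `1/100 ∈ Icc (1/100) (1/50)`).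

So the card's split `Metrical ∧ Topological ∧ ChargeSplitting ⇒ crux` detours through statements
that are each AT MOST as strong as the crux: proving either lemma is never wasted work, and a
refutation of either refutes the crux.  (Bookkeeping only; recorded to certify the direction of the
typed statements and the absence of junk in the `Icc`/`Nat.card` encodings.)
-/

noncomputable section

namespace Summit.AtomisticToContinuum.Crystallization.Cruxes.TruncatedCensusGap.Triage3

open Literature.MathematicalPhysics.StatisticalMechanics Literature.Geometry.DiscreteGeometry
open Summit.AtomisticToContinuum.Crystallization.Theses.PricedLinkCensus (TruncatedCensusGap)
open Summit.AtomisticToContinuum.Crystallization.Cruxes.TruncatedCensusGap.Sketch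

/-- The crux, read through the sketch's abbreviations `eStar`, `Vχ` (definitional). -/
theorem tcg_iff' :
    TruncatedCensusGap ↔ ∃ κ : ℝ, 0 < κ ∧ ∀ (N : ℕ) (y : Fin N → EuclideanSpace ℝ (Fin 3)),
      Function.Injective y →
        (N : ℝ) * eStar + κ * (Nat.card {i : Fin N // ¬ IsChargeFree (1 / 100 : ℝ) y i} : ℝ)
          ≤ interactionEnergy Vχ y :=
  Iff.rfl

/-- Monotonicity of `Nat.card` of subtypes of `Fin N` under implication of the predicates. -/
theorem natCard_subtype_mono {N : ℕ} {p q : Fin N → Prop} (h : ∀ i, p i → q i) :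
    Nat.card {i // p i} ≤ Nat.card {i // q i} :=
  Nat.card_le_card_of_injective (fun x => (⟨x.1, h x.1 x.2⟩ : {i // q i})) (by
    intro x x' hxx'
    simp only [Subtype.mk.injEq] at hxx'
    exact Subtype.ext hxx')

/-- **Card B's metrical gap follows from the crux** (with allowance `C = 0`). -/
theorem metricalChargeGap_of_tcg (h : TruncatedCensusGap) : MetricalChargeGap := by
  obtain ⟨κ, hκ, H⟩ := tcg_iff'.1 h
  refine ⟨κ, 0, hκ, le_rfl, fun N y hy => ?_⟩
  have h1 := H N y hy
  have hsub : (Nat.card {i : Fin N // ¬ IsChargeFree (1 / 100 : ℝ) y i ∧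
        ∀ j : Fin N, dist (y i) (y j) ≤ 4 →
          ∃ η ∈ Set.Icc (1 / 100 : ℝ) (1 / 50), IsChargeFree η y j} : ℝ)
      ≤ Nat.card {i : Fin N // ¬ IsChargeFree (1 / 100 : ℝ) y i} := by
    exact_mod_cast natCard_subtype_mono
      (p := fun i => ¬ IsChargeFree (1 / 100 : ℝ) y i ∧ ∀ j : Fin N, dist (y i) (y j) ≤ 4 →
          ∃ η ∈ Set.Icc (1 / 100 : ℝ) (1 / 50), IsChargeFree η y j)
      (q := fun i => ¬ IsChargeFree (1 / 100 : ℝ) y i) fun i hi => hi.1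
  have h2 := mul_le_mul_of_nonneg_left hsub hκ.le
  rw [zero_mul, sub_zero]
  linarith

/-- **Card B's topological gap follows from the crux.** -/
theorem topologicalChargeGap_of_tcg (h : TruncatedCensusGap) : TopologicalChargeGap := by
  obtain ⟨κ, hκ, H⟩ := tcg_iff'.1 h
  refine ⟨κ, hκ, fun N y hy => ?_⟩
  have h1 := H N y hy
  have hmem : (1 / 100 : ℝ) ∈ Set.Icc (1 / 100 : ℝ) (1 / 50) := ⟨le_rfl, by norm_num⟩
  have hsub : (Nat.card {j : Fin N // ∀ η ∈ Set.Icc (1 / 100 : ℝ) (1 / 50), ¬ IsChargeFree η y j} : ℝ)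
      ≤ Nat.card {i : Fin N // ¬ IsChargeFree (1 / 100 : ℝ) y i} := by
    exact_mod_cast natCard_subtype_mono
      (p := fun j => ∀ η ∈ Set.Icc (1 / 100 : ℝ) (1 / 50), ¬ IsChargeFree η y j)
      (q := fun i => ¬ IsChargeFree (1 / 100 : ℝ) y i) fun j hj => hj (1 / 100) hmem
  have h2 := mul_le_mul_of_nonneg_left hsub hκ.le
  linarith

end Summit.AtomisticToContinuum.Crystallization.Cruxes.TruncatedCensusGap.Triage3

end
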